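import Summits.Parity.GeneralizedHardyLittlewood.Theorems.PrimeLevelFamEdgeMomentsBeyondDiagonalDiagHarmonic
import Summits.Parity.GeneralizedHardyLittlewood.Theorems.PrimeLevelFamEdgeMomentsBeyondDiagonalDiagRieszRecursion
import HarnessLib

/-!
# Route `PrimeLevelFamEdge`, crux K_A `MomentsBeyondDiagonal` (stmt-Parity-20007), line «petersson_layers» v4, stub `stub_diag`:
# **the harmonic engine at every order: `H_a(x) = Σ_{n≤x}|W(n)|E_n logᵃ(x/n) = ζ(2)·log^{a+1}x/(a+1) + O_a((1+log x)ᵃ)`**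

Census item G5 (first half, continued) of the `stub_diag` repair census. The companion file `…DiagHarmonic` gives the
orders `a = 0, 1` from the `X²` chain's exact collapses; here every order follows by the integral recursion
`H_{a+1}(x) = (a+1)∫₁ˣ H_a(w)dw/w` (`…DiagRieszRecursion.flatRiesz_succ_eq_integral`, valid for `a ≥ 1`), exactly as
for the `1/ζ²` Riesz means of `…DiagRiesz`:

* `abs_sum_absW_mainConst_log_pow_succ_sub_le` — orders `m + 1` by induction on `m`;
* `abs_sum_absW_mainConst_log_pow_sub_le` — **every `a ≥ 0`: `|H_a(x) − ζ(2)log^{a+1}x/(a+1)| ≤ C_a(1+log x)ᵃ`, `x ≥ 1`**.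

With `|W(n)|E_n = ζ(2)μ²(n)/φ(n)` this is `Σ_{n≤x} μ²(n)φ(n)⁻¹logᵃ(x/n) = log^{a+1}x/(a+1) + O((1+log x)ᵃ)`, the
`n`-sum engine for the main terms of the general-profile kernel form (weights `P″(u_n)²`, `P″(u_n)P′(u_n)` expanded in
powers of `log(M/n)`). Def-free; theorems only. Helper `--supports stmt-Parity-20007`; closes nothing; K_A, K_B and the
Parity summit are NOT proved; nothing about Landau–Siegel zeros.

## References
* E. Kowalski, P. Michel, J. VanderKam, J. reine angew. Math. 526 (2000), Prop. 5.1 p. 18 (the `n`-sums behind (31)).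
  [cite: KowalskiMichelVanderKam2000, Prop. 5.1 — derivation]
* H. L. Montgomery, R. C. Vaughan, *Multiplicative Number Theory I*, CUP 2007, §5.1 (Riesz typical means).
  [cite: MontgomeryVaughan2007, §5.1 — derivation]
-/

noncomputable section

open scoped Real ArithmeticFunction.Moebius ArithmeticFunction.sigma ArithmeticFunction.zeta
open Finset ArithmeticFunction MeasureTheory intervalIntegral

namespace Summit.Parity.GeneralizedHardyLittlewood.Theorems.MomentsBeyondDiagonal.DiagKernel

open Literature.NumberTheory.LFunctions Literature.NumberTheory.LFunctions.KMV2000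
open MollifierMainTerm (W)
open Summit.Parity.GeneralizedHardyLittlewood.Theorems.BeyondDiagonalBeatsQuarter.KernelFormXSq (mainConst)

/-! ### Every order by the integral recursion -/

/-- **Orders `a ≥ 1` by induction**: `|H_{m+1}(z) − ζ(2)log^{m+2}z/(m+2)| ≤ C_m(1 + log z)^{m+1}` for `z ≥ 1`
(`H_{c+1}(z) = (c+1)∫₁ᶻ H_c(w)dw/w` for `c ≥ 1`, `∫₁ᶻ logʲw dw/w = log^{j+1}z/(j+1)`,
`∫₁ᶻ(1+log w)ʲdw/w ≤ (1+log z)^{j+1}/(j+1)`). [cite: MontgomeryVaughan2007, §5.1 — derivation (Riesz typical means)] -/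
theorem abs_sum_absW_mainConst_log_pow_succ_sub_le (m : ℕ) :
    ∃ C : ℝ, 0 < C ∧ ∀ z : ℝ, 1 ≤ z →
      |∑ n ∈ Icc 1 ⌊z⌋₊, |W n| * mainConst n * Real.log (z / n) ^ (m + 1) -
          π ^ 2 / 6 * Real.log z ^ (m + 2) / ((m : ℝ) + 2)| ≤ C * (1 + Real.log z) ^ (m + 1) := by
  induction m with
  | zero =>
    obtain ⟨C, hC, h⟩ := abs_sum_absW_mainConst_log_sub_le
    refine ⟨C, hC, fun z hz ↦ ?_⟩
    have := h z hz
    norm_num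
    simpa using this
  | succ m ih =>
    obtain ⟨C, hC, h⟩ := ih
    refine ⟨C, hC, fun z hz ↦ ?_⟩
    have hz0 : 0 < z := zero_lt_one.trans_le hz
    have hne : ∀ w ∈ Set.uIcc 1 z, w ≠ 0 := by
      intro w hw
      rw [Set.uIcc_of_le hz] at hw
      exact (zero_lt_one.trans_le hw.1).ne'
    have hc1 : 1 ≤ m + 1 := by omega
    set b : ℕ → ℝ := fun n ↦ |W n| * mainConst n with hbdef
    set F : ℝ → ℝ := fun w ↦ ∑ k ∈ Icc 1 ⌊z⌋₊,
      b k * (((m + 1 : ℕ) + 1 : ℝ) * Real.posLog (w / k) ^ (m + 1) / w) with hFdef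
    have hR : ∑ n ∈ Icc 1 ⌊z⌋₊, |W n| * mainConst n * Real.log (z / n) ^ (m + 1 + 1) =
        ∫ w in (1 : ℝ)..z, F w := by
      have := flatRiesz_succ_eq_integral b hc1 hz
      simpa only [hbdef] using this
    -- the main term as an integral
    set A : ℝ := π ^ 2 / 6 with hAdef
    have hmain : π ^ 2 / 6 * Real.log z ^ (m + 1 + 2) / (((m + 1 : ℕ) : ℝ) + 2) =
        ∫ w in (1 : ℝ)..z, A * (Real.log w ^ (m + 2) / w) := by
      rw [intervalIntegral.integral_const_mul, integral_log_pow_div hz (m + 2), hAdef,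
        show m + 1 + 2 = m + 2 + 1 by ring]
      push_cast
      ring
    have hFint : IntervalIntegrable F volume 1 z := by
      refine ContinuousOn.intervalIntegrable
        (continuousOn_finsetSum _ fun k _ ↦ continuousOn_const.mul ?_)
      exact continuousOn_const_mul_posLog_pow_div _ (k : ℝ) (m + 1) hne
    have hGint : IntervalIntegrable (fun w : ℝ ↦ A * (Real.log w ^ (m + 2) / w)) volume 1 z := by
      refine ContinuousOn.intervalIntegrable (continuousOn_const.mul ?_)
      exact ((continuousOn_id.log hne).pow (m + 2)).div continuousOn_id hne
    have hBint : IntervalIntegrable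
        (fun w : ℝ ↦ ((m : ℝ) + 2) * C * ((1 + Real.log w) ^ (m + 1) / w)) volume 1 z := by
      refine ContinuousOn.intervalIntegrable (continuousOn_const.mul ?_)
      exact ((continuousOn_const.add (continuousOn_id.log hne)).pow (m + 1)).div continuousOn_id hne
    rw [hR, hmain, ← intervalIntegral.integral_sub hFint hGint]
    have hbound : ∀ᵐ w : ℝ, w ∈ Set.Ioc 1 z →
        ‖F w - A * (Real.log w ^ (m + 2) / w)‖ ≤ ((m : ℝ) + 2) * C * ((1 + Real.log w) ^ (m + 1) / w) := by
      refine Filter.Eventually.of_forall fun w hw ↦ ?_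
      have hw1 : 1 ≤ w := hw.1.le
      have hw0 : 0 < w := zero_lt_one.trans_le hw1
      have hwz : ⌊w⌋₊ ≤ ⌊z⌋₊ := Nat.floor_le_floor hw.2
      have hFw : F w = (((m + 1 : ℕ) : ℝ) + 1) / w *
          ∑ k ∈ Icc 1 ⌊w⌋₊, b k * Real.log (w / k) ^ (m + 1) := by
        rw [hFdef]
        exact sum_posLog_pow_eq b hc1 hw1 hwz
      have key : F w - A * (Real.log w ^ (m + 2) / w) =
          ((m : ℝ) + 2) / w * (∑ k ∈ Icc 1 ⌊w⌋₊, b k * Real.log (w / k) ^ (m + 1) -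
            π ^ 2 / 6 * Real.log w ^ (m + 2) / ((m : ℝ) + 2)) := by
        rw [hFw, hAdef]; push_cast; field_simp; ring
      rw [key, Real.norm_eq_abs, abs_mul, abs_of_pos (by positivity : (0 : ℝ) < ((m : ℝ) + 2) / w)]
      have hb := h w hw1
      simp only [hbdef] at hb ⊢
      calc ((m : ℝ) + 2) / w * |∑ k ∈ Icc 1 ⌊w⌋₊, |W k| * mainConst k * Real.log (w / k) ^ (m + 1) -
              π ^ 2 / 6 * Real.log w ^ (m + 2) / ((m : ℝ) + 2)|
          ≤ ((m : ℝ) + 2) / w * (C * (1 + Real.log w) ^ (m + 1)) :=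
            mul_le_mul_of_nonneg_left hb (by positivity)
        _ = ((m : ℝ) + 2) * C * ((1 + Real.log w) ^ (m + 1) / w) := by
            field_simp
    refine (Real.norm_eq_abs _ ▸ norm_integral_le_of_norm_le hz hbound hBint).trans ?_
    rw [intervalIntegral.integral_const_mul, integral_one_add_log_pow_div hz (m + 1)]
    have hL : 0 ≤ Real.log z := Real.log_nonneg hz
    have h1 : 1 ≤ (1 + Real.log z) ^ (m + 1 + 1) := one_le_pow₀ (by linarith)
    have hm1 : (0 : ℝ) < (m : ℝ) + 2 := by positivity
    push_cast
    rw [show ((m : ℝ) + 2) * C * (((1 + Real.log z) ^ (m + 1 + 1) - 1) / ((m : ℝ) + 1 + 1)) =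
      C * ((1 + Real.log z) ^ (m + 1 + 1) - 1) by field_simp; ring]
    nlinarith

/-- **The harmonic engine, every order**: for each `a ≥ 0` there is `C_a` with
`|Σ_{n≤x}|W(n)|E_n logᵃ(x/n) − ζ(2)·log^{a+1}x/(a+1)| ≤ C_a·(1 + log x)ᵃ` for all `x ≥ 1`
(`W = μ/(id·ψ)`, `E_n = ζ(2)∏_{p∣n}(p+1)/(p−1)`, so `|W(n)|E_n = ζ(2)μ²(n)/φ(n)`).
[cite: KowalskiMichelVanderKam2000, Prop. 5.1 — derivation (the `n`-sums behind (31), general profile)] -/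
theorem abs_sum_absW_mainConst_log_pow_sub_le (a : ℕ) :
    ∃ C : ℝ, 0 < C ∧ ∀ x : ℝ, 1 ≤ x →
      |∑ n ∈ Icc 1 ⌊x⌋₊, |W n| * mainConst n * Real.log (x / n) ^ a -
          π ^ 2 / 6 * Real.log x ^ (a + 1) / ((a : ℝ) + 1)| ≤ C * (1 + Real.log x) ^ a := by
  rcases a with _ | m
  · obtain ⟨C, hC, h⟩ := abs_sum_absW_mainConst_sub_le
    refine ⟨C, hC, fun x hx ↦ ?_⟩
    have := h x hx
    norm_num
    simpa using this
  · obtain ⟨C, hC, h⟩ := abs_sum_absW_mainConst_log_pow_succ_sub_le m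
    refine ⟨C, hC, fun x hx ↦ ?_⟩
    have := h x hx
    push_cast
    rw [show (m : ℝ) + 1 + 1 = (m : ℝ) + 2 by ring]
    exact this

end Summit.Parity.GeneralizedHardyLittlewood.Theorems.MomentsBeyondDiagonal.DiagKernel

end
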